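import Summits.ValiantsHypothesis.ValiantsHypothesis.Theorems.GrenetZeonDualUnipotentThreeHalvesRadicalCoarseningFineFlag

/-!
# `GrenetZeon.DualUnipotentThreeHalves` (stmt-ValiantsHypothesis-24318), R2 `HeavyTopLaw` — ι(4) = 3 ASSEMBLY, part (B):
# cyclic (Jordan) bases for a `4 × 4` nilpotent of index 4 and of index 3 (htc cell PREREG Q2; eng-1 spec S2(b)(c))

For the kernel assembly of «ι(4) = 3» one conjugates a member of maximal nilindex to its normal form:

* `exists_conj_eq_J4`: `A⁴ = 0`, `A³ ≠ 0` ⇒ mutually inverse `Q, P` with `Q A P = J₄ = E₁₂+E₂₃+E₃₄` — the cyclic basis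
  `(A³v, A²v, Av, v)`;
* `exists_conj_eq_E12_E23`: `A³ = 0`, `A² ≠ 0` ⇒ `Q A P = E₁₂ + E₂₃` — the basis `(A²v, Av, v, f)` with `A f = 0`, where
  the fourth vector is obtained from ANY completion `f₀` by the correction `f = f₀ − αAv − βv` after reading off
  `δ = γ = 0` from `(Q₀ A P₀)³ = 0` in the provisional basis `(f₀, A²v, Av, v)` (no rank–nullity needed).

`Q = [b.equivFun]`, `P = [b.equivFun⁻¹]` for the constructed basis `b` (✓ `RadicalCoarseningFineFlag.conj_entry_eq_repr`,
`toMatrix'_equivFun_mul_symm`, `toMatrix'_symm_mul_equivFun`).  Indices `Fin 4 = {0,1,2,3}`.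
Honest framing: linear-algebra lemmas toward a datum (ι(4) = 3) of the instance table; nothing here proves or refutes
`HeavyTopLaw`, 24318, S3b or 8062; `VP ≠ VNP` is not moved; no summit statement is proved here.  No definitions,
no named facts. [eng-1 NOTE-iota4 / assembly spec; val-port-3 g2]
-/

noncomputable section

-- single-conjunct layout: Sub = Summit, duplicated namespace component intended
set_option linter.dupNamespace false

namespace Summit.ValiantsHypothesis.ValiantsHypothesis.Theorems.GrenetZeon.HeavyTopIotaFour

open Matrix
open Summit.ValiantsHypothesis.ValiantsHypothesis.Theorems.GrenetZeon.RadicalCoarsening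
  (conj_entry_eq_repr toMatrix'_equivFun_mul_symm toMatrix'_symm_mul_equivFun)

/-! ## §1 Small tools -/

/-- A non-zero matrix moves some vector. -/
theorem exists_mulVec_ne_zero {m : ℕ} {M : Matrix (Fin m) (Fin m) ℂ} (hM : M ≠ 0) :
    ∃ v : Fin m → ℂ, M *ᵥ v ≠ 0 := by
  by_contra h
  push Not at h
  apply hM
  ext i j
  have := congrFun (h (Pi.single j 1)) i
  simpa [Matrix.mulVec] using this

/-- Powers past the nilindex vanish on vectors: `A^p = 0`, `p ≤ k` ⇒ `A^k v = 0`. -/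
theorem pow_mulVec_eq_zero_of_le {m : ℕ} (A : Matrix (Fin m) (Fin m) ℂ) {p k : ℕ} (hp : A ^ p = 0) (hk : p ≤ k)
    (v : Fin m → ℂ) : A ^ k *ᵥ v = 0 := by
  rw [pow_eq_zero_of_le hk hp, Matrix.zero_mulVec]

/-- `A^a (A^b v) = A^(a+b) v`. -/
theorem pow_mulVec_pow_mulVec {m : ℕ} (A : Matrix (Fin m) (Fin m) ℂ) (a b : ℕ) (v : Fin m → ℂ) :
    A ^ a *ᵥ (A ^ b *ᵥ v) = A ^ (a + b) *ᵥ v := by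
  rw [Matrix.mulVec_mulVec, ← pow_add]

/-- `A (A^k v) = A^(k+1) v`. -/
theorem mulVec_pow_mulVec {m : ℕ} (A : Matrix (Fin m) (Fin m) ℂ) (k : ℕ) (v : Fin m → ℂ) :
    A *ᵥ (A ^ k *ᵥ v) = A ^ (k + 1) *ᵥ v := by
  rw [Matrix.mulVec_mulVec, ← pow_succ']

/-- Conjugating by the coordinate matrices of a basis transports cubes: `(Q A P)³ = Q A³ P`. -/
theorem conj_basis_pow_three (b : Module.Basis (Fin 4) ℂ (Fin 4 → ℂ)) (A : Matrix (Fin 4) (Fin 4) ℂ) :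
    (LinearMap.toMatrix' (b.equivFun : (Fin 4 → ℂ) →ₗ[ℂ] (Fin 4 → ℂ)) * A *
        LinearMap.toMatrix' (b.equivFun.symm : (Fin 4 → ℂ) →ₗ[ℂ] (Fin 4 → ℂ))) ^ 3 =
      LinearMap.toMatrix' (b.equivFun : (Fin 4 → ℂ) →ₗ[ℂ] (Fin 4 → ℂ)) * A ^ 3 *
        LinearMap.toMatrix' (b.equivFun.symm : (Fin 4 → ℂ) →ₗ[ℂ] (Fin 4 → ℂ)) := by
  set Q := LinearMap.toMatrix' (b.equivFun : (Fin 4 → ℂ) →ₗ[ℂ] (Fin 4 → ℂ))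
  set P := LinearMap.toMatrix' (b.equivFun.symm : (Fin 4 → ℂ) →ₗ[ℂ] (Fin 4 → ℂ))
  have hPQ : P * Q = 1 := toMatrix'_symm_mul_equivFun b
  calc (Q * A * P) ^ 3 = Q * A * (P * Q) * A * (P * Q) * A * P := by
        simp only [pow_succ, pow_zero, Matrix.one_mul, Matrix.mul_assoc]
    _ = Q * A ^ 3 * P := by rw [hPQ]; simp only [pow_succ, pow_zero, Matrix.one_mul, Matrix.mul_one, Matrix.mul_assoc]

/-! ## §2 Index 4: the cyclic basis and `Q A P = J₄` -/

/-- The cyclic vectors `(A³v, A²v, Av, v)` of a vector with `A³v ≠ 0` (`A⁴ = 0`) are linearly independent. -/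
theorem linearIndependent_cyclic_four (A : Matrix (Fin 4) (Fin 4) ℂ) (h4 : A ^ 4 = 0) (v : Fin 4 → ℂ)
    (hv : A ^ 3 *ᵥ v ≠ 0) : LinearIndependent ℂ ![A ^ 3 *ᵥ v, A ^ 2 *ᵥ v, A ^ 1 *ᵥ v, A ^ 0 *ᵥ v] := by
  rw [Fintype.linearIndependent_iff]
  intro g hg
  simp only [Fin.sum_univ_four, Matrix.cons_val_zero, Matrix.cons_val_one, Matrix.cons_val] at hg
  -- apply `A^k` to the relation
  have happ : ∀ k : ℕ, g 0 • (A ^ (k + 3) *ᵥ v) + g 1 • (A ^ (k + 2) *ᵥ v) + g 2 • (A ^ (k + 1) *ᵥ v)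
      + g 3 • (A ^ k *ᵥ v) = 0 := by
    intro k
    have := congrArg (fun w => A ^ k *ᵥ w) hg
    simpa only [Matrix.mulVec_add, Matrix.mulVec_smul, Matrix.mulVec_zero, pow_mulVec_pow_mulVec, add_zero] using this
  have h3 : g 3 = 0 := by
    have := happ 3
    rw [pow_mulVec_eq_zero_of_le A h4 (by norm_num), pow_mulVec_eq_zero_of_le A h4 (by norm_num),
      pow_mulVec_eq_zero_of_le A h4 (by norm_num), smul_zero, smul_zero, smul_zero, zero_add, zero_add, zero_add]
      at this
    exact (smul_eq_zero.mp this).resolve_right hv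
  have h2 : g 2 = 0 := by
    have := happ 2
    rw [pow_mulVec_eq_zero_of_le A h4 (by norm_num), pow_mulVec_eq_zero_of_le A h4 (by norm_num), h3,
      smul_zero, smul_zero, zero_smul, zero_add, zero_add, add_zero] at this
    exact (smul_eq_zero.mp this).resolve_right hv
  have h1 : g 1 = 0 := by
    have := happ 1
    rw [pow_mulVec_eq_zero_of_le A h4 (by norm_num), h2, h3, smul_zero, zero_smul, zero_smul, zero_add, add_zero,
      add_zero] at this
    exact (smul_eq_zero.mp this).resolve_right hv
  have h0 : g 0 = 0 := by
    have := happ 0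
    rw [h1, h2, h3, zero_smul, zero_smul, zero_smul, add_zero, add_zero, add_zero] at this
    exact (smul_eq_zero.mp this).resolve_right hv
  intro i; fin_cases i <;> assumption

/-- **Index-4 normal form.**  `A⁴ = 0`, `A³ ≠ 0` ⇒ `Q A P = J₄` for mutually inverse `Q, P`. [NOTE-iota4 §2; spec S2(c)] -/
theorem exists_conj_eq_J4 (A : Matrix (Fin 4) (Fin 4) ℂ) (h4 : A ^ 4 = 0) (h3 : A ^ 3 ≠ 0) :
    ∃ Q P : Matrix (Fin 4) (Fin 4) ℂ, Q * P = 1 ∧ P * Q = 1 ∧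
      Q * A * P = !![0, 1, 0, 0; 0, 0, 1, 0; 0, 0, 0, 1; 0, 0, 0, 0] := by
  classical
  obtain ⟨v, hv⟩ := exists_mulVec_ne_zero h3
  have hli := linearIndependent_cyclic_four A h4 v hv
  let b : Module.Basis (Fin 4) ℂ (Fin 4 → ℂ) :=
    basisOfLinearIndependentOfCardEqFinrank hli (by simp)
  have hb : ∀ i, b i = ![A ^ 3 *ᵥ v, A ^ 2 *ᵥ v, A ^ 1 *ᵥ v, A ^ 0 *ᵥ v] i := fun i => by
    simp [b, coe_basisOfLinearIndependentOfCardEqFinrank]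
  refine ⟨LinearMap.toMatrix' (b.equivFun : (Fin 4 → ℂ) →ₗ[ℂ] (Fin 4 → ℂ)),
    LinearMap.toMatrix' (b.equivFun.symm : (Fin 4 → ℂ) →ₗ[ℂ] (Fin 4 → ℂ)),
    toMatrix'_equivFun_mul_symm b, toMatrix'_symm_mul_equivFun b, ?_⟩
  -- the basis vectors and the action `A b₀ = 0`, `A b_{j+1} = b_j`
  have hb0 : b 0 = A ^ 3 *ᵥ v := by rw [hb]; rfl
  have hb1 : b 1 = A ^ 2 *ᵥ v := by rw [hb]; rfl
  have hb2 : b 2 = A ^ 1 *ᵥ v := by rw [hb]; rfl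
  have hb3 : b 3 = A ^ 0 *ᵥ v := by rw [hb]; rfl
  have hA0 : A *ᵥ b 0 = 0 := by
    rw [hb0]; exact (mulVec_pow_mulVec A 3 v).trans (by rw [h4, Matrix.zero_mulVec])
  have hA1 : A *ᵥ b 1 = b 0 := by rw [hb1, hb0]; exact mulVec_pow_mulVec A 2 v
  have hA2 : A *ᵥ b 2 = b 1 := by rw [hb2, hb1]; exact mulVec_pow_mulVec A 1 v
  have hA3 : A *ᵥ b 3 = b 2 := by rw [hb3, hb2]; exact mulVec_pow_mulVec A 0 v
  ext i j
  rw [conj_entry_eq_repr]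
  fin_cases j <;> simp only [Fin.zero_eta, Fin.mk_one, Fin.reduceFinMk, Fin.isValue]
  · rw [hA0, map_zero, Finsupp.zero_apply]; fin_cases i <;> simp
  · rw [hA1, b.repr_self]; fin_cases i <;> simp
  · rw [hA2, b.repr_self]; fin_cases i <;> simp
  · rw [hA3, b.repr_self]; fin_cases i <;> simp

/-! ## §3 Index 3: the basis `(A²v, Av, v, f)` with `A f = 0`, and `Q A P = E₁₂ + E₂₃` -/

/-- The cyclic vectors `(A²v, Av, v)` (`A³ = 0`, `A²v ≠ 0`) together with a vector `f ∉ span{A²v, Av, v}` are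
linearly independent, in the order `(A²v, Av, v, f)`. -/
theorem linearIndependent_cyclic_three_snoc (A : Matrix (Fin 4) (Fin 4) ℂ) (h3 : A ^ 3 = 0) (v : Fin 4 → ℂ)
    (hv : A ^ 2 *ᵥ v ≠ 0) (f : Fin 4 → ℂ)
    (hf : f ∉ Submodule.span ℂ ({A ^ 2 *ᵥ v, A ^ 1 *ᵥ v, A ^ 0 *ᵥ v} : Set (Fin 4 → ℂ))) :
    LinearIndependent ℂ ![A ^ 2 *ᵥ v, A ^ 1 *ᵥ v, A ^ 0 *ᵥ v, f] := by
  rw [Fintype.linearIndependent_iff]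
  intro g hg
  simp only [Fin.sum_univ_four, Matrix.cons_val_zero, Matrix.cons_val_one, Matrix.cons_val] at hg
  -- the `f`-coefficient vanishes, else `f ∈ span`
  have h3' : g 3 = 0 := by
    by_contra hne
    apply hf
    have : f = -(g 3)⁻¹ • (g 0 • (A ^ 2 *ᵥ v) + g 1 • (A ^ 1 *ᵥ v) + g 2 • (A ^ 0 *ᵥ v)) := by
      have h' : g 3 • f = -(g 0 • (A ^ 2 *ᵥ v) + g 1 • (A ^ 1 *ᵥ v) + g 2 • (A ^ 0 *ᵥ v)) :=
        eq_neg_of_add_eq_zero_right hg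
      rw [neg_smul, ← smul_neg, ← h', smul_smul, inv_mul_cancel₀ hne, one_smul]
    rw [this]
    refine Submodule.smul_mem _ _ (Submodule.add_mem _ (Submodule.add_mem _ ?_ ?_) ?_)
    · exact Submodule.smul_mem _ _ (Submodule.subset_span (by simp))
    · exact Submodule.smul_mem _ _ (Submodule.subset_span (by simp))
    · exact Submodule.smul_mem _ _ (Submodule.subset_span (by simp))
  rw [h3', zero_smul, add_zero] at hg
  have happ : ∀ k : ℕ, g 0 • (A ^ (k + 2) *ᵥ v) + g 1 • (A ^ (k + 1) *ᵥ v) + g 2 • (A ^ k *ᵥ v) = 0 := by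
    intro k
    have := congrArg (fun w => A ^ k *ᵥ w) hg
    simpa only [Matrix.mulVec_add, Matrix.mulVec_smul, Matrix.mulVec_zero, pow_mulVec_pow_mulVec, add_zero] using this
  have h2 : g 2 = 0 := by
    have := happ 2
    rw [pow_mulVec_eq_zero_of_le A h3 (by norm_num), pow_mulVec_eq_zero_of_le A h3 (by norm_num), smul_zero,
      smul_zero, zero_add, zero_add] at this
    exact (smul_eq_zero.mp this).resolve_right hv
  have h1 : g 1 = 0 := by
    have := happ 1
    rw [pow_mulVec_eq_zero_of_le A h3 (by norm_num), h2, smul_zero, zero_smul, zero_add, add_zero] at this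
    exact (smul_eq_zero.mp this).resolve_right hv
  have h0 : g 0 = 0 := by
    have := happ 0
    rw [h1, h2, zero_smul, zero_smul, add_zero, add_zero] at this
    exact (smul_eq_zero.mp this).resolve_right hv
  intro i; fin_cases i <;> assumption

/-- Some standard basis vector lies outside a proper span in `ℂ⁴` spanned by three vectors. -/
theorem exists_single_not_mem_span_three (x y z : Fin 4 → ℂ) :
    ∃ k : Fin 4, (Pi.single k 1 : Fin 4 → ℂ) ∉ Submodule.span ℂ ({x, y, z} : Set (Fin 4 → ℂ)) := by
  by_contra h
  push Not at h
  set S := Submodule.span ℂ ({x, y, z} : Set (Fin 4 → ℂ))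
  have htop : (⊤ : Submodule ℂ (Fin 4 → ℂ)) ≤ S := by
    rw [← (Pi.basisFun ℂ (Fin 4)).span_eq, Submodule.span_le]
    rintro _ ⟨k, rfl⟩
    rw [Pi.basisFun_apply]
    exact h k
  have h4 : Module.finrank ℂ (⊤ : Submodule ℂ (Fin 4 → ℂ)) ≤ Module.finrank ℂ S :=
    Submodule.finrank_mono htop
  rw [finrank_top, Module.finrank_fin_fun] at h4
  have h3 : Module.finrank ℂ S ≤ 3 := by
    have := finrank_span_finset_le_card (R := ℂ) (M := Fin 4 → ℂ) ({x, y, z} : Finset (Fin 4 → ℂ))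
    simp only [Finset.coe_insert, Finset.coe_singleton] at this
    exact this.trans Finset.card_le_three
  omega

/-- **Index-3 normal form.**  `A³ = 0`, `A² ≠ 0` ⇒ `Q A P = E₁₂ + E₂₃` for mutually inverse `Q, P`.
The fourth basis vector `f` with `A f = 0` is obtained from a provisional completion `f₀` by reading `δ = γ = 0` off
`(Q₀ A P₀)³ = 0` and correcting `f = f₀ − α·Av − β·v`. [NOTE-iota4 §3 set-up; spec S2(b)] -/
theorem exists_conj_eq_E12_E23 (A : Matrix (Fin 4) (Fin 4) ℂ) (h3 : A ^ 3 = 0) (h2 : A ^ 2 ≠ 0) :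
    ∃ Q P : Matrix (Fin 4) (Fin 4) ℂ, Q * P = 1 ∧ P * Q = 1 ∧
      Q * A * P = !![0, 1, 0, 0; 0, 0, 1, 0; 0, 0, 0, 0; 0, 0, 0, 0] := by
  classical
  obtain ⟨v, hv⟩ := exists_mulVec_ne_zero h2
  -- provisional fourth vector
  obtain ⟨k, hk⟩ := exists_single_not_mem_span_three (A ^ 2 *ᵥ v) (A ^ 1 *ᵥ v) (A ^ 0 *ᵥ v)
  set f₀ : Fin 4 → ℂ := Pi.single k 1 with hf₀
  have hli₀ := linearIndependent_cyclic_three_snoc A h3 v hv f₀ hk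
  let b₀ : Module.Basis (Fin 4) ℂ (Fin 4 → ℂ) := basisOfLinearIndependentOfCardEqFinrank hli₀ (by simp)
  have hb₀ : ∀ i, b₀ i = ![A ^ 2 *ᵥ v, A ^ 1 *ᵥ v, A ^ 0 *ᵥ v, f₀] i := fun i => by
    simp [b₀, coe_basisOfLinearIndependentOfCardEqFinrank]
  -- coordinates of `A f₀` in `b₀`
  set α := b₀.repr (A *ᵥ f₀) 0
  set β := b₀.repr (A *ᵥ f₀) 1
  set γ := b₀.repr (A *ᵥ f₀) 2
  set δ := b₀.repr (A *ᵥ f₀) 3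
  have hAf₀ : A *ᵥ f₀ = α • (A ^ 2 *ᵥ v) + β • (A ^ 1 *ᵥ v) + γ • (A ^ 0 *ᵥ v) + δ • f₀ := by
    have := (b₀.sum_repr (A *ᵥ f₀)).symm
    rw [Fin.sum_univ_four] at this
    rw [show b₀ 0 = A ^ 2 *ᵥ v by rw [hb₀]; rfl, show b₀ 1 = A ^ 1 *ᵥ v by rw [hb₀]; rfl,
      show b₀ 2 = A ^ 0 *ᵥ v by rw [hb₀]; rfl, show b₀ 3 = f₀ by rw [hb₀]; rfl] at this
    exact this
  -- actions on the cyclic vectors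
  have hA0 : A *ᵥ (A ^ 2 *ᵥ v) = 0 := (mulVec_pow_mulVec A 2 v).trans (by rw [h3, Matrix.zero_mulVec])
  have hA1 : A *ᵥ (A ^ 1 *ᵥ v) = A ^ 2 *ᵥ v := mulVec_pow_mulVec A 1 v
  have hA2 : A *ᵥ (A ^ 0 *ᵥ v) = A ^ 1 *ᵥ v := mulVec_pow_mulVec A 0 v
  -- the provisional matrix and its cube
  set Q₀ := LinearMap.toMatrix' (b₀.equivFun : (Fin 4 → ℂ) →ₗ[ℂ] (Fin 4 → ℂ))
  set P₀ := LinearMap.toMatrix' (b₀.equivFun.symm : (Fin 4 → ℂ) →ₗ[ℂ] (Fin 4 → ℂ))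
  have hb₀0 : b₀ 0 = A ^ 2 *ᵥ v := by rw [hb₀]; rfl
  have hb₀1 : b₀ 1 = A ^ 1 *ᵥ v := by rw [hb₀]; rfl
  have hb₀2 : b₀ 2 = A ^ 0 *ᵥ v := by rw [hb₀]; rfl
  have hb₀3 : b₀ 3 = f₀ := by rw [hb₀]; rfl
  have hB0 : A *ᵥ b₀ 0 = 0 := by rw [hb₀0]; exact hA0
  have hB1 : A *ᵥ b₀ 1 = b₀ 0 := by rw [hb₀1, hb₀0]; exact hA1
  have hB2 : A *ᵥ b₀ 2 = b₀ 1 := by rw [hb₀2, hb₀1]; exact hA2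
  have hM : Q₀ * A * P₀ = !![0, 1, 0, α; 0, 0, 1, β; 0, 0, 0, γ; 0, 0, 0, δ] := by
    ext i j
    rw [conj_entry_eq_repr]
    fin_cases j <;> simp only [Fin.zero_eta, Fin.mk_one, Fin.reduceFinMk, Fin.isValue]
    · rw [hB0, map_zero, Finsupp.zero_apply]; fin_cases i <;> simp
    · rw [hB1, b₀.repr_self]; fin_cases i <;> simp
    · rw [hB2, b₀.repr_self]; fin_cases i <;> simp
    · rw [hb₀3]; fin_cases i <;> simp [α, β, γ, δ]
  have hM3 : (Q₀ * A * P₀) ^ 3 = 0 := by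
    rw [conj_basis_pow_three b₀ A, h3, Matrix.mul_zero, Matrix.zero_mul]
  rw [hM] at hM3
  have hδ : δ = 0 := by
    have := congrFun (congrFun hM3 3) 3
    simp [pow_succ, Matrix.mul_apply, Fin.sum_univ_four] at this
    exact this
  have hγ : γ = 0 := by
    have := congrFun (congrFun hM3 0) 3
    simp [pow_succ, Matrix.mul_apply, Fin.sum_univ_four, hδ] at this
    exact this
  -- the corrected fourth vector
  set f : Fin 4 → ℂ := f₀ - α • (A ^ 1 *ᵥ v) - β • (A ^ 0 *ᵥ v) with hfdef
  have hAf : A *ᵥ f = 0 := by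
    rw [hfdef, Matrix.mulVec_sub, Matrix.mulVec_sub, Matrix.mulVec_smul, Matrix.mulVec_smul, hAf₀, hA1, hA2, hγ, hδ]
    simp
  have hf : f ∉ Submodule.span ℂ ({A ^ 2 *ᵥ v, A ^ 1 *ᵥ v, A ^ 0 *ᵥ v} : Set (Fin 4 → ℂ)) := by
    intro hmem
    apply hk
    have : f₀ = f + α • (A ^ 1 *ᵥ v) + β • (A ^ 0 *ᵥ v) := by rw [hfdef]; abel
    rw [this]
    refine Submodule.add_mem _ (Submodule.add_mem _ hmem ?_) ?_
    · exact Submodule.smul_mem _ _ (Submodule.subset_span (by simp))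
    · exact Submodule.smul_mem _ _ (Submodule.subset_span (by simp))
  have hli := linearIndependent_cyclic_three_snoc A h3 v hv f hf
  let b : Module.Basis (Fin 4) ℂ (Fin 4 → ℂ) := basisOfLinearIndependentOfCardEqFinrank hli (by simp)
  have hb : ∀ i, b i = ![A ^ 2 *ᵥ v, A ^ 1 *ᵥ v, A ^ 0 *ᵥ v, f] i := fun i => by
    simp [b, coe_basisOfLinearIndependentOfCardEqFinrank]
  refine ⟨LinearMap.toMatrix' (b.equivFun : (Fin 4 → ℂ) →ₗ[ℂ] (Fin 4 → ℂ)),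
    LinearMap.toMatrix' (b.equivFun.symm : (Fin 4 → ℂ) →ₗ[ℂ] (Fin 4 → ℂ)),
    toMatrix'_equivFun_mul_symm b, toMatrix'_symm_mul_equivFun b, ?_⟩
  have hb0' : b 0 = A ^ 2 *ᵥ v := by rw [hb]; rfl
  have hb1' : b 1 = A ^ 1 *ᵥ v := by rw [hb]; rfl
  have hb2' : b 2 = A ^ 0 *ᵥ v := by rw [hb]; rfl
  have hb3' : b 3 = f := by rw [hb]; rfl
  have hC0 : A *ᵥ b 0 = 0 := by rw [hb0']; exact hA0
  have hC1 : A *ᵥ b 1 = b 0 := by rw [hb1', hb0']; exact hA1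
  have hC2 : A *ᵥ b 2 = b 1 := by rw [hb2', hb1']; exact hA2
  have hC3 : A *ᵥ b 3 = 0 := by rw [hb3']; exact hAf
  ext i j
  rw [conj_entry_eq_repr]
  fin_cases j <;> simp only [Fin.zero_eta, Fin.mk_one, Fin.reduceFinMk, Fin.isValue]
  · rw [hC0, map_zero, Finsupp.zero_apply]; fin_cases i <;> simp
  · rw [hC1, b.repr_self]; fin_cases i <;> simp
  · rw [hC2, b.repr_self]; fin_cases i <;> simp
  · rw [hC3, map_zero, Finsupp.zero_apply]; fin_cases i <;> simp

end Summit.ValiantsHypothesis.ValiantsHypothesis.Theorems.GrenetZeon.HeavyTopIotaFour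

end
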